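import Summits.Ventures.GridStability.Lyapunov.PolytopeRateKit
import HarnessLib

/-!
# GridStability/Lyapunov/PolytopeRateEdgeKit — «SP-RATE-POLYTOPE», the instance kit for EDGE-LIST data:
# an `EdgeRateCert` for `b = symmetrize (edgeWeight src tgt wt)` at half-angle equilibria from ONE check
# per listed edge and orientation

Cell `gridfusion` (LADDER-GRIDFUSION), seat gridfusion-lyap-1 (g8). Companion of `PolytopeRateKit.lean`
(`HiCheck`, `hi/lo_endpoint_facts`, `edgeRateCert_of_ratChecks` for pair-indexed data). Model-2's sparse
instances (`Models/NE39SP.lean`, `Models/WSCC9SP.lean`) carry the couplings as an indexed edge list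
(`m` edges `src e → tgt e`, weights `wt e`, `b = symmetrize (edgeWeight src tgt wt)`) and the
equilibrium as half-angle tangents `δ₀ = halfAngle t` (`sin σ*_e = 2q_e/(1 + q_e²)`,
`cos σ*_e = (1 − q_e²)/(1 + q_e²)`, `q_e = (t_src − t_tgt)/(1 + t_src t_tgt)`, model-2's
`two_mul_arctan_sub` / lyap-1 g6's `sin_halfAngle_sub'`, `cos_halfAngle_sub`). HERE:
**`exists_edgeRateCert_of_edgeChecks`** — if every listed edge passes `HiCheck` in both orientations
(offsets `ρhi e`, `ρlo e`; coupling entered as the LOWER bound `wt e ≤ b`, hence the hypothesis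
`0 ≤ c`), then SOME test-angle family `(ℓ, u)` satisfies `EdgeRateCert p (halfAngle t) c m k ℓ u`
(for a coupled pair the test angles are read off a witnessing edge, in its orientation or mirrored).
Bookkeeping only; no definition, no named fact; standard axioms.
-/

noncomputable section

open Set Real Finset
open Summit.Ventures.GridStability.Models.StructurePreserving
open Summit.Ventures.GridStability.Models.StructurePreserving.Params
open Summit.Ventures.GridStability.Lyapunov.StructurePreserving

namespace Summit.Ventures.GridStability.Lyapunov.PolytopeSector

variable {n m : ℕ} {src tgt : Fin m → Fin n} {wt : Fin m → ℝ}

/-- From `0 ≤ c < w·U` and `0 ≤ w ≤ b`: `c < b·U` (indeed `U > 0`). [folklore] -/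
theorem lt_mul_of_lt_mul_of_le {c w b U : ℝ} (hc : 0 ≤ c) (hw : 0 ≤ w) (hwb : w ≤ b)
    (h : c < w * U) : c < b * U := by
  have hU : 0 < U := by
    by_contra hU
    push Not at hU
    have : w * U ≤ 0 := mul_nonpos_of_nonneg_of_nonpos hw hU
    linarith
  exact h.trans_le (mul_le_mul_of_nonneg_right hwb hU.le)

/-- **The ten certificate facts of ONE listed edge `e`, in its own orientation** `(i, j) = (src e, tgt e)`
(`a = σ*_e = halfAngle t (src e) − halfAngle t (tgt e)`, `sin a = tsin q_e`, `cos a = tcos q_e`): from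
the two checks, the upper test angle `a + 8·arctan(ρhi e)` and the lower one `a − 8·arctan(ρlo e)`
satisfy the `EdgeRateCert` inequalities with the coupling `wt e`; and `m ≤ cos a`. [folklore] -/
theorem edge_endpoint_facts (wtQ : Fin m → ℚ) (tQ : Fin n → ℚ) {t : Fin n → ℝ}
    (ht : ∀ i, t i = tQ i) (hwt0 : ∀ e, 0 ≤ wtQ e) (hprod : ∀ e, -1 < tQ (src e) * tQ (tgt e))
    (e : Fin m) (ha : |halfAngle t (src e) - halfAngle t (tgt e)| ≤ π / 2)
    (ρhi ρlo : Fin m → ℚ) (c mm k : ℚ) (hm : 0 ≤ mm) (hk0 : 0 ≤ k)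
    (hchk :
      HiCheck (tsin ((tQ (src e) - tQ (tgt e)) / (1 + tQ (src e) * tQ (tgt e))))
          (tcos ((tQ (src e) - tQ (tgt e)) / (1 + tQ (src e) * tQ (tgt e)))) (ρhi e) (wtQ e) c mm k ∧
      HiCheck (-tsin ((tQ (src e) - tQ (tgt e)) / (1 + tQ (src e) * tQ (tgt e))))
          (tcos ((tQ (src e) - tQ (tgt e)) / (1 + tQ (src e) * tQ (tgt e)))) (ρlo e) (wtQ e) c mm k) :
    let a := halfAngle t (src e) - halfAngle t (tgt e)
    (a ≤ a + 8 * Real.arctan (ρhi e : ℝ) ∧ a + 8 * Real.arctan (ρhi e : ℝ) ≤ π ∧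
      (c : ℝ) < (wtQ e : ℝ) * branchEnergy (a + 8 * Real.arctan (ρhi e : ℝ)) a ∧
      (mm : ℝ) * ((a + 8 * Real.arctan (ρhi e : ℝ)) - a)
        ≤ Real.sin (a + 8 * Real.arctan (ρhi e : ℝ)) - Real.sin a ∧
      (k : ℝ) * branchEnergy (a + 8 * Real.arctan (ρhi e : ℝ)) a
        ≤ ((a + 8 * Real.arctan (ρhi e : ℝ)) - a) * (Real.sin (a + 8 * Real.arctan (ρhi e : ℝ)) - Real.sin a)) ∧
    (-π ≤ a - 8 * Real.arctan (ρlo e : ℝ) ∧ a - 8 * Real.arctan (ρlo e : ℝ) ≤ a ∧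
      (c : ℝ) < (wtQ e : ℝ) * branchEnergy (a - 8 * Real.arctan (ρlo e : ℝ)) a ∧
      (mm : ℝ) * (a - (a - 8 * Real.arctan (ρlo e : ℝ)))
        ≤ Real.sin a - Real.sin (a - 8 * Real.arctan (ρlo e : ℝ)) ∧
      (k : ℝ) * branchEnergy (a - 8 * Real.arctan (ρlo e : ℝ)) a
        ≤ ((a - 8 * Real.arctan (ρlo e : ℝ)) - a) * (Real.sin (a - 8 * Real.arctan (ρlo e : ℝ)) - Real.sin a)) ∧
    (mm : ℝ) ≤ Real.cos a := by
  intro a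
  have hmR : (0 : ℝ) ≤ (mm : ℝ) := by exact_mod_cast hm
  have hkR : (0 : ℝ) ≤ (k : ℝ) := by exact_mod_cast hk0
  have hprodR : -1 < t (src e) * t (tgt e) := by rw [ht, ht]; exact_mod_cast hprod e
  have hq : (((tQ (src e) - tQ (tgt e)) / (1 + tQ (src e) * tQ (tgt e)) : ℚ) : ℝ)
      = hq (t (src e)) (t (tgt e)) := by
    unfold hq; rw [ht, ht]; push_cast; rfl
  set T : ℝ := ((tsin ((tQ (src e) - tQ (tgt e)) / (1 + tQ (src e) * tQ (tgt e))) : ℚ) : ℝ) with hT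
  set C : ℝ := ((tcos ((tQ (src e) - tQ (tgt e)) / (1 + tQ (src e) * tQ (tgt e))) : ℚ) : ℝ) with hC
  have hsa : Real.sin a = T := by
    rw [hT, tsin_ratCast, hq]
    exact sin_halfAngle_sub' hprodR
  have hca : Real.cos a = C := by
    rw [hC, tcos_ratCast, hq]
    exact cos_halfAngle_sub hprodR
  have hb : (0 : ℝ) ≤ (wtQ e : ℝ) := by exact_mod_cast hwt0 e
  have h1 := hiCheck_ratCast hchk.1
  have h2 := hiCheck_ratCast hchk.2
  push_cast at h2
  rw [← hT, ← hC] at h1 h2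
  exact ⟨hi_endpoint_facts hsa hca ha hb hmR hkR h1, lo_endpoint_facts hsa hca ha hb hmR hkR h2,
    hca ▸ h1.2.2.2.2.2⟩

/-- **`EdgeRateCert` for edge-list data from one check per listed edge and orientation.** DATA: an edge
list `src, tgt : Fin m → Fin n` with rational weights `wt e = wtQ e ≥ 0`, rational half-angle tangents
`t = tQ` with `t_src·t_tgt > −1` on every listed edge, structure-preserving data `p` with
`p.b = symmetrize (edgeWeight src tgt wt)` and coupled equilibrium line angles `|δ₀ᵢ − δ₀ⱼ| ≤ π/2`
at `δ₀ = halfAngle t`; rationals `0 ≤ c`, `0 ≤ m`, `0 ≤ k ≤ 1`; offsets `ρhi, ρlo : Fin m → ℚ`; and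
for every listed edge the two checks of `edge_endpoint_facts`. CLAIM:
`EdgeRateCert p (halfAngle t) c m k ℓ u` for some test angles `(ℓ, u)` (for a coupled pair `(i, j)` a
witnessing edge is chosen; if it is listed as `(j, i)` its facts are mirrored, `σ*ᵢⱼ = −σ*_e`; the
coupling is upgraded from `wt e` to `bᵢⱼ ≥ wt e`). [folklore] -/
theorem exists_edgeRateCert_of_edgeChecks (wtQ : Fin m → ℚ) (tQ : Fin n → ℚ) {t : Fin n → ℝ}
    (hwt : ∀ e, wt e = wtQ e) (ht : ∀ i, t i = tQ i) (hwt0 : ∀ e, 0 ≤ wtQ e)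
    (hprod : ∀ e, -1 < tQ (src e) * tQ (tgt e))
    {p : Params n} (hpb : p.b = symmetrize (edgeWeight src tgt wt))
    (h0 : ∀ i j, p.b i j ≠ 0 → |halfAngle t i - halfAngle t j| ≤ π / 2)
    (ρhi ρlo : Fin m → ℚ) (c mm k : ℚ) (hc : 0 ≤ c) (hm : 0 ≤ mm) (hk0 : 0 ≤ k) (hk1 : k ≤ 1)
    (hchk : ∀ e,
      HiCheck (tsin ((tQ (src e) - tQ (tgt e)) / (1 + tQ (src e) * tQ (tgt e))))
          (tcos ((tQ (src e) - tQ (tgt e)) / (1 + tQ (src e) * tQ (tgt e)))) (ρhi e) (wtQ e) c mm k ∧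
      HiCheck (-tsin ((tQ (src e) - tQ (tgt e)) / (1 + tQ (src e) * tQ (tgt e))))
          (tcos ((tQ (src e) - tQ (tgt e)) / (1 + tQ (src e) * tQ (tgt e)))) (ρlo e) (wtQ e) c mm k) :
    ∃ ℓ u : Fin n → Fin n → ℝ, EdgeRateCert p (halfAngle t) (c : ℝ) (mm : ℝ) (k : ℝ) ℓ u := by
  have hwtR : ∀ e, 0 ≤ wt e := fun e => by rw [hwt e]; exact_mod_cast hwt0 e
  have hcR : (0 : ℝ) ≤ (c : ℝ) := by exact_mod_cast hc
  -- a witnessing edge for every coupled pair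
  have hex : ∀ i j, p.b i j ≠ 0 → ∃ e, (src e = i ∧ tgt e = j) ∨ (src e = j ∧ tgt e = i) :=
    fun i j hij => exists_edge_of_symmetrize_ne_zero (by rw [← hpb]; exact hij)
  classical
  let E : ∀ i j, p.b i j ≠ 0 → Fin m := fun i j hij => Classical.choose (hex i j hij)
  have hE : ∀ i j (hij : p.b i j ≠ 0),
      (src (E i j hij) = i ∧ tgt (E i j hij) = j) ∨ (src (E i j hij) = j ∧ tgt (E i j hij) = i) :=
    fun i j hij => Classical.choose_spec (hex i j hij)
  -- lower bound of the coupling by the witnessing weight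
  have hwle : ∀ i j (hij : p.b i j ≠ 0), (wtQ (E i j hij) : ℝ) ≤ p.b i j := by
    intro i j hij
    rw [← hwt, hpb]
    rcases hE i j hij with ⟨hs, ht'⟩ | ⟨hs, ht'⟩
    · exact (le_edgeWeight_of_edge hwtR _ hs ht').trans (le_symmetrize_left (edgeWeight_nonneg hwtR) i j)
    · exact (le_edgeWeight_of_edge hwtR _ hs ht').trans (le_symmetrize_right (edgeWeight_nonneg hwtR) i j)
  -- test angles
  refine ⟨fun i j => if hij : p.b i j ≠ 0 then
      (if src (E i j hij) = i ∧ tgt (E i j hij) = j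
        then (halfAngle t i - halfAngle t j) - 8 * Real.arctan (ρlo (E i j hij) : ℝ)
        else (halfAngle t i - halfAngle t j) - 8 * Real.arctan (ρhi (E i j hij) : ℝ))
      else halfAngle t i - halfAngle t j,
    fun i j => if hij : p.b i j ≠ 0 then
      (if src (E i j hij) = i ∧ tgt (E i j hij) = j
        then (halfAngle t i - halfAngle t j) + 8 * Real.arctan (ρhi (E i j hij) : ℝ)
        else (halfAngle t i - halfAngle t j) + 8 * Real.arctan (ρlo (E i j hij) : ℝ))
      else halfAngle t i - halfAngle t j, ?_⟩
  -- the ten facts for every coupled pair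
  have key : ∀ i j (hij : p.b i j ≠ 0),
      let σ := halfAngle t i - halfAngle t j
      let uu := if src (E i j hij) = i ∧ tgt (E i j hij) = j
        then σ + 8 * Real.arctan (ρhi (E i j hij) : ℝ) else σ + 8 * Real.arctan (ρlo (E i j hij) : ℝ)
      let ll := if src (E i j hij) = i ∧ tgt (E i j hij) = j
        then σ - 8 * Real.arctan (ρlo (E i j hij) : ℝ) else σ - 8 * Real.arctan (ρhi (E i j hij) : ℝ)
      (σ ≤ uu ∧ uu ≤ π ∧ (c : ℝ) < p.b i j * branchEnergy uu σ ∧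
        (mm : ℝ) * (uu - σ) ≤ Real.sin uu - Real.sin σ ∧
        (k : ℝ) * branchEnergy uu σ ≤ (uu - σ) * (Real.sin uu - Real.sin σ)) ∧
      (-π ≤ ll ∧ ll ≤ σ ∧ (c : ℝ) < p.b i j * branchEnergy ll σ ∧
        (mm : ℝ) * (σ - ll) ≤ Real.sin σ - Real.sin ll ∧
        (k : ℝ) * branchEnergy ll σ ≤ (ll - σ) * (Real.sin ll - Real.sin σ)) ∧
      (mm : ℝ) ≤ Real.cos σ := by
    intro i j hij σ uu ll
    have hb0 : (0 : ℝ) ≤ (wtQ (E i j hij) : ℝ) := by exact_mod_cast hwt0 (E i j hij)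
    by_cases hor : src (E i j hij) = i ∧ tgt (E i j hij) = j
    · -- the edge is listed as `(i, j)`
      have huu : uu = σ + 8 * Real.arctan (ρhi (E i j hij) : ℝ) := by simp only [uu, if_pos hor]
      have hll : ll = σ - 8 * Real.arctan (ρlo (E i j hij) : ℝ) := by simp only [ll, if_pos hor]
      obtain ⟨hs, ht'⟩ := hor
      have hσ : σ = halfAngle t (src (E i j hij)) - halfAngle t (tgt (E i j hij)) := by rw [hs, ht']
      have ha : |halfAngle t (src (E i j hij)) - halfAngle t (tgt (E i j hij))| ≤ π / 2 := by
        rw [← hσ]; exact h0 i j hij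
      obtain ⟨⟨f1, f2, f3, f4, f5⟩, ⟨g1, g2, g3, g4, g5⟩, hcos⟩ :=
        edge_endpoint_facts wtQ tQ ht hwt0 hprod (E i j hij) ha ρhi ρlo c mm k hm hk0 (hchk (E i j hij))
      rw [← hσ] at f1 f2 f3 f4 f5 g1 g2 g3 g4 g5 hcos
      rw [huu, hll]
      exact ⟨⟨f1, f2, lt_mul_of_lt_mul_of_le hcR hb0 (hwle i j hij) f3, f4, f5⟩,
        ⟨g1, g2, lt_mul_of_lt_mul_of_le hcR hb0 (hwle i j hij) g3, g4, g5⟩, hcos⟩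
    · -- the edge is listed as `(j, i)`: mirror
      have huu : uu = σ + 8 * Real.arctan (ρlo (E i j hij) : ℝ) := by simp only [uu, if_neg hor]
      have hll : ll = σ - 8 * Real.arctan (ρhi (E i j hij) : ℝ) := by simp only [ll, if_neg hor]
      have hor' : src (E i j hij) = j ∧ tgt (E i j hij) = i := by
        rcases hE i j hij with h | h
        · exact absurd h hor
        · exact h
      obtain ⟨hs, ht'⟩ := hor'
      have ha : |halfAngle t (src (E i j hij)) - halfAngle t (tgt (E i j hij))| ≤ π / 2 := by
        have h1 := h0 i j hij
        rw [hs, ht', abs_sub_comm]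
        exact h1
      obtain ⟨⟨f1, f2, f3, f4, f5⟩, ⟨g1, g2, g3, g4, g5⟩, hcos⟩ :=
        edge_endpoint_facts wtQ tQ ht hwt0 hprod (E i j hij) ha ρhi ρlo c mm k hm hk0 (hchk (E i j hij))
      rw [hs, ht'] at f1 f2 f3 f4 f5 g1 g2 g3 g4 g5 hcos
      -- now `a = halfAngle t j - halfAngle t i = -σ`
      have hσa : σ = -(halfAngle t j - halfAngle t i) := by simp only [σ]; ring
      rw [huu, hll, hσa]
      set a := halfAngle t j - halfAngle t i with ha_def
      have e1 : -a + 8 * Real.arctan (ρlo (E i j hij) : ℝ) = -(a - 8 * Real.arctan (ρlo (E i j hij) : ℝ)) := by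
        ring
      have e2 : -a - 8 * Real.arctan (ρhi (E i j hij) : ℝ) = -(a + 8 * Real.arctan (ρhi (E i j hij) : ℝ)) := by
        ring
      rw [e1, e2]
      refine ⟨⟨by linarith, by linarith, ?_, ?_, ?_⟩, ⟨by linarith, by linarith, ?_, ?_, ?_⟩,
        by rw [Real.cos_neg]; exact hcos⟩
      · rw [branchEnergy_neg_neg]; exact lt_mul_of_lt_mul_of_le hcR hb0 (hwle i j hij) g3
      · rw [Real.sin_neg, Real.sin_neg]; linarith
      · rw [branchEnergy_neg_neg, Real.sin_neg, Real.sin_neg]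
        have e3 : (-(a - 8 * Real.arctan (ρlo (E i j hij) : ℝ)) - -a)
            * (-Real.sin (a - 8 * Real.arctan (ρlo (E i j hij) : ℝ)) - -Real.sin a)
            = ((a - 8 * Real.arctan (ρlo (E i j hij) : ℝ)) - a)
              * (Real.sin (a - 8 * Real.arctan (ρlo (E i j hij) : ℝ)) - Real.sin a) := by ring
        rw [e3]; exact g5
      · rw [branchEnergy_neg_neg]; exact lt_mul_of_lt_mul_of_le hcR hb0 (hwle i j hij) f3
      · rw [Real.sin_neg, Real.sin_neg]; linarith
      · rw [branchEnergy_neg_neg, Real.sin_neg, Real.sin_neg]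
        have e3 : (-(a + 8 * Real.arctan (ρhi (E i j hij) : ℝ)) - -a)
            * (-Real.sin (a + 8 * Real.arctan (ρhi (E i j hij) : ℝ)) - -Real.sin a)
            = ((a + 8 * Real.arctan (ρhi (E i j hij) : ℝ)) - a)
              * (Real.sin (a + 8 * Real.arctan (ρhi (E i j hij) : ℝ)) - Real.sin a) := by ring
        rw [e3]; exact f5
  exact
    { neg_pi_le := fun i j hij => by simp only [dif_pos hij]; exact (key i j hij).2.1.1
      lo_le := fun i j hij => by simp only [dif_pos hij]; exact (key i j hij).2.1.2.1
      le_hi := fun i j hij => by simp only [dif_pos hij]; exact (key i j hij).1.1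
      le_pi := fun i j hij => by simp only [dif_pos hij]; exact (key i j hij).1.2.1
      level_lo := fun i j hij => by simp only [dif_pos hij]; exact (key i j hij).2.1.2.2.1
      level_hi := fun i j hij => by simp only [dif_pos hij]; exact (key i j hij).1.2.2.1
      slope_le_cos := fun i j hij => by have h := (key i j hij).2.2; exact h
      slope_lo := fun i j hij => by simp only [dif_pos hij]; exact (key i j hij).2.1.2.2.2.1
      slope_hi := fun i j hij => by simp only [dif_pos hij]; exact (key i j hij).1.2.2.2.1
      ratio_le_one := by exact_mod_cast hk1
      ratio_lo := fun i j hij => by simp only [dif_pos hij]; exact (key i j hij).2.1.2.2.2.2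
      ratio_hi := fun i j hij => by simp only [dif_pos hij]; exact (key i j hij).1.2.2.2.2 }

end Summit.Ventures.GridStability.Lyapunov.PolytopeSector

end
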